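import Literature.Probability.NegativeDependence.CNAImpliesHNLC
import HarnessLib

/-!
# Monotone 0/1 images of NA families are NA (Dubhashi–Ranjan, Prop. 7 (2); Joag-Dev–Proschan, P6)

D. Dubhashi, D. Ranjan, *Balls and bins: a study in negative dependence*, Random Struct. Algorithms 13 (1998)
99–124 (held `paper:doi-10-1002-sici-1098-2418-199809-13-2-99-aid-rsa1-3-0-co-2-m`), §2.1, verbatim (p. 6):

> **Proposition 7** […] 2. Let `X := (X_1, ⋯, X_n)` satisfy (−A). Let `I_1, ⋯, I_k ⊆ [n]` be disjoint index sets,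
> for some positive integer `k`. For `j ∈ [k]`, let `h_j : ℝ^{|I_j|} → ℝ` be functions that are all non-decreasing
> or all non-increasing, and define `Y_j := h_j(X_i, i ∈ I_j)`. Then the vector `Y := (Y_1, ⋯, Y_k)` also
> satisfies (−A). That is, non-decreasing (or non-increasing) functions of disjoint subsets of negatively
> associated variables are also negatively associated.

([13] there = K. Joag-Dev, F. Proschan, Ann. Statist. 11 (1983), Property P6.)

## What is here (the 0/1-valued case, which stays inside the tree's framework of weights on `2^σ`)

* §1 **All `h_j` non-increasing, `I_j = {j}`**: the flipped family `1 - X` is NA — `flipWeight μ (S) = μ(Sᶜ)`,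
  `ex_flipWeight`, **`IsNegAssoc.flip`** (from the decreasing-functions form of NA, the tree's
  `IsNegAssoc.antitone_antitone`).
* §2 **All `h_j = 𝟏_{𝒜_j}` non-decreasing indicators**: the joint law `eventImage 𝒜 μ` on `2^κ` of the indicator
  vector `(𝟏_{𝒜_j}(X))_{j ∈ κ}` of increasing events `𝒜_j` depending on pairwise disjoint coordinate sets `I_j`;
  `ex_eventImage` (change of variables), `mass_eventImage`, and **`IsNegAssoc.eventImage`** (Prop. 7 (2)): pull the
  test functions back along `S ↦ {j : S ∈ 𝒜_j}`, which is increasing and turns "depends on `D ⊆ κ`" into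
  "depends on `⋃_{j ∈ D} I_j`". The non-increasing indicator case is the composite of the two
  (`IsNegAssoc.eventImage_antitone`).

`-- TODO(general form)`: real-valued `h_j` (the image variables are then no longer 0/1-valued and leave the
vocabulary of weights on `2^κ`).

## References

* [DubhashiRanjan1998] D. Dubhashi, D. Ranjan, Balls and bins: a study in negative dependence, Random Struct.
  Algorithms 13 (1998) — §2.1 Def. 1, Prop. 7 (2).
* [JoagDevProschan1983] K. Joag-Dev, F. Proschan, Negative association of random variables with applications,
  Ann. Statist. 11 (1983) — Property P6.
* [BorceaBrandenLiggett2007] J. Borcea, P. Brändén, T. M. Liggett — §2.1 Def. 2.7 (NA).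
-/

noncomputable section

open Finset
open Literature.Combinatorics.Sahi2008

universe u

namespace Literature.Probability.NegativeDependence

variable {σ : Type u} [Fintype σ] [DecidableEq σ]

/-! ## §1 Flipping all coordinates -/

section Flip

/-- **The flipped family `1 - X`**: the weight `S ↦ μ(Sᶜ)`. [cite: DubhashiRanjan1998, §2.1 Prop. 7 (2)
(non-increasing `h_j`)] -/
def flipWeight (μ : Finset σ → ℝ) : Finset σ → ℝ := fun S => μ Sᶜ

/-- Unfolding `flipWeight`. [cite: DubhashiRanjan1998, §2.1 Prop. 7 (2)] -/
theorem flipWeight_apply (μ : Finset σ → ℝ) (S : Finset σ) : flipWeight μ S = μ Sᶜ := rfl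

/-- Change of variables `S ↦ Sᶜ` in expectations. [cite: DubhashiRanjan1998, §2.1 Prop. 7 (2)] -/
theorem ex_flipWeight (μ F : Finset σ → ℝ) : ex (flipWeight μ) F = ex μ (fun S => F Sᶜ) := by
  rw [ex_def, ex_def]
  exact Fintype.sum_equiv (Equiv.mk (fun S : Finset σ => Sᶜ) (fun S => Sᶜ) compl_compl compl_compl) _ _
    fun S => by simp [flipWeight_apply]

/-- `(flip μ)(Ω) = μ(Ω)`. [cite: DubhashiRanjan1998, §2.1 Prop. 7 (2)] -/
theorem mass_flipWeight (μ : Finset σ → ℝ) : mass (flipWeight μ) = mass μ := by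
  have h := ex_flipWeight μ fun _ => 1
  simp only [ex_def, mul_one] at h
  rw [mass_def, mass_def, h]

/-- A function of `Sᶜ` depending on `E` (as a function of `S`) still depends on `E`. [cite: DubhashiRanjan1998,
§2.1 Def. 1] -/
theorem DeterminedBy.comp_compl {F : Finset σ → ℝ} {E : Finset σ} (hF : DeterminedBy F E) :
    DeterminedBy (fun S => F Sᶜ) E := fun S T hST => hF _ _ (by
  ext x
  simp only [Finset.mem_inter, Finset.mem_compl]
  constructor
  · rintro ⟨hxS, hxE⟩
    exact ⟨fun hxT => hxS ((Finset.ext_iff.1 hST x).2 (Finset.mem_inter.2 ⟨hxT, hxE⟩) |> fun h =>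
      (Finset.mem_inter.1 h).1), hxE⟩
  · rintro ⟨hxT, hxE⟩
    exact ⟨fun hxS => hxT ((Finset.ext_iff.1 hST x).1 (Finset.mem_inter.2 ⟨hxS, hxE⟩) |> fun h =>
      (Finset.mem_inter.1 h).1), hxE⟩)

/-- **NA is invariant under flipping all coordinates** (`X ↦ 1 - X`; Prop. 7 (2) with `I_j = {j}`,
`h_j(x) = 1 - x` non-increasing). [cite: DubhashiRanjan1998, §2.1 Prop. 7 (2); JoagDevProschan1983, Property P6] -/
theorem IsNegAssoc.flip {μ : Finset σ → ℝ} (h : IsNegAssoc μ) : IsNegAssoc (flipWeight μ) := by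
  intro F G hF hG E₁ E₂ hFE hGE hdisj
  rw [ex_flipWeight, ex_flipWeight, ex_flipWeight, mass_flipWeight]
  exact h.antitone_antitone (F := fun S => F Sᶜ) (G := fun S => G Sᶜ)
    (fun S T hST => hF (Finset.compl_subset_compl.2 hST)) (fun S T hST => hG (Finset.compl_subset_compl.2 hST))
    hFE.comp_compl hGE.comp_compl hdisj

end Flip

/-! ## §2 Increasing indicator images -/

section Image

variable {κ : Type u} [Fintype κ] [DecidableEq κ]

/-- **The indicator vector of a family of events**: the joint (unnormalized) law on `2^κ` of
`(𝟏_{𝒜_j}(X))_{j ∈ κ}` under `μ`, i.e. `J ↦ μ{S : {j : S ∈ 𝒜_j} = J}` ("define `Y_j := h_j(X_i, i ∈ I_j)`").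
[cite: DubhashiRanjan1998, §2.1 Prop. 7 (2)] -/
def eventImage (𝒜 : κ → Finset (Finset σ)) (μ : Finset σ → ℝ) : Finset κ → ℝ := fun J =>
  ∑ S : Finset σ, if (Finset.univ.filter fun j => S ∈ 𝒜 j) = J then μ S else 0

/-- Unfolding `eventImage`. [cite: DubhashiRanjan1998, §2.1 Prop. 7 (2)] -/
theorem eventImage_apply (𝒜 : κ → Finset (Finset σ)) (μ : Finset σ → ℝ) (J : Finset κ) :
    eventImage 𝒜 μ J = ∑ S : Finset σ, if (Finset.univ.filter fun j => S ∈ 𝒜 j) = J then μ S else 0 := rfl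

/-- The indicator-vector law of a nonnegative weight is nonnegative. [cite: DubhashiRanjan1998, §2.1
Prop. 7 (2)] -/
theorem eventImage_nonneg {𝒜 : κ → Finset (Finset σ)} {μ : Finset σ → ℝ} (h0 : ∀ S, 0 ≤ μ S) (J : Finset κ) :
    0 ≤ eventImage 𝒜 μ J :=
  Finset.sum_nonneg fun S _ => by split_ifs; exacts [h0 S, le_rfl]

/-- **Change of variables**: `E_Y[F] = E_X[F(Y(X))]`. [cite: DubhashiRanjan1998, §2.1 Prop. 7 (2)] -/
theorem ex_eventImage (𝒜 : κ → Finset (Finset σ)) (μ : Finset σ → ℝ) (F : Finset κ → ℝ) :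
    ex (eventImage 𝒜 μ) F = ex μ (fun S => F (Finset.univ.filter fun j => S ∈ 𝒜 j)) := by
  rw [ex_def, ex_def]
  simp only [eventImage_apply, Finset.sum_mul]
  rw [Finset.sum_comm]
  refine Finset.sum_congr rfl fun S _ => ?_
  simp only [ite_mul, zero_mul]
  rw [Finset.sum_ite_eq]
  rw [if_pos (Finset.mem_univ _)]

/-- `Y(Ω) = X(Ω)`. [cite: DubhashiRanjan1998, §2.1 Prop. 7 (2)] -/
theorem mass_eventImage (𝒜 : κ → Finset (Finset σ)) (μ : Finset σ → ℝ) : mass (eventImage 𝒜 μ) = mass μ := by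
  have h := ex_eventImage 𝒜 μ fun _ => 1
  simp only [ex_def, mul_one] at h
  rw [mass_def, mass_def, h]

omit [Fintype σ] in
/-- Events depending on `I` are decided by `S ∩ I`. [cite: DubhashiRanjan1998, §2.1 Def. 1] -/
theorem mem_iff_of_determinedBy {𝒞 : Finset (Finset σ)} {I : Finset σ} (h : DeterminedBy (setInd 𝒞) I)
    {S T : Finset σ} (hST : S ∩ I = T ∩ I) : S ∈ 𝒞 ↔ T ∈ 𝒞 := by
  have key := h S T hST
  rw [setInd_apply, setInd_apply] at key
  by_cases hS : S ∈ 𝒞 <;> by_cases hT : T ∈ 𝒞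
  · exact ⟨fun _ => hT, fun _ => hS⟩
  · rw [if_pos hS, if_neg hT] at key; exact absurd key one_ne_zero
  · rw [if_neg hS, if_pos hT] at key; exact absurd key.symm one_ne_zero
  · exact ⟨fun h' => absurd h' hS, fun h' => absurd h' hT⟩

/-- **Dubhashi–Ranjan, Proposition 7 (2), indicator case: increasing events of disjoint blocks of an NA family
form an NA family.** For an NA weight `μ` on `2^σ`, increasing events `𝒜_j` (`j ∈ κ`) depending on pairwise
disjoint coordinate sets `I_j`, the indicator vector `(𝟏_{𝒜_j})_j` is NA. [cite: DubhashiRanjan1998, §2.1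
Prop. 7 (2); JoagDevProschan1983, Property P6] -/
theorem IsNegAssoc.eventImage {μ : Finset σ → ℝ} (hμ : IsNegAssoc μ) {𝒜 : κ → Finset (Finset σ)}
    (h𝒜 : ∀ j, IsUpperSet (𝒜 j : Set (Finset σ))) {I : κ → Finset σ}
    (hI : ∀ j, DeterminedBy (setInd (𝒜 j)) (I j)) (hdisj : ∀ j l, j ≠ l → Disjoint (I j) (I l)) :
    IsNegAssoc (eventImage 𝒜 μ) := by
  intro F G hF hG D₁ D₂ hFD hGD hD
  set φ : Finset σ → Finset κ := fun S => Finset.univ.filter fun j => S ∈ 𝒜 j with hφ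
  have hφm : Monotone φ := fun S T hST j hj => by
    rw [hφ, Finset.mem_filter] at hj ⊢
    exact ⟨hj.1, h𝒜 j hST hj.2⟩
  -- pulling back "depends on `D`" to "depends on `⋃_{j ∈ D} I_j`"
  have pull : ∀ (H : Finset κ → ℝ) (D : Finset κ), DeterminedBy H D →
      DeterminedBy (fun S => H (φ S)) (D.biUnion I) := by
    intro H D hHD S T hST
    refine hHD _ _ ?_
    ext j
    simp only [Finset.mem_inter, hφ, Finset.mem_filter, Finset.mem_univ, true_and]
    constructor
    · rintro ⟨hS, hj⟩
      have hIU : I j ⊆ D.biUnion I := Finset.subset_biUnion_of_mem I hj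
      have hSTj : S ∩ I j = T ∩ I j := by
        rw [← Finset.inter_eq_right.2 hIU, ← Finset.inter_assoc, ← Finset.inter_assoc, hST]
      exact ⟨(mem_iff_of_determinedBy (hI j) hSTj).1 hS, hj⟩
    · rintro ⟨hT, hj⟩
      have hIU : I j ⊆ D.biUnion I := Finset.subset_biUnion_of_mem I hj
      have hSTj : S ∩ I j = T ∩ I j := by
        rw [← Finset.inter_eq_right.2 hIU, ← Finset.inter_assoc, ← Finset.inter_assoc, hST]
      exact ⟨(mem_iff_of_determinedBy (hI j) hSTj).2 hT, hj⟩
  have hdisjU : Disjoint (D₁.biUnion I) (D₂.biUnion I) := by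
    rw [Finset.disjoint_biUnion_left]
    intro j hj
    rw [Finset.disjoint_biUnion_right]
    intro l hl
    exact hdisj j l fun h => Finset.disjoint_left.1 hD hj (h ▸ hl)
  rw [ex_eventImage, ex_eventImage, ex_eventImage, mass_eventImage]
  exact hμ (F := fun S => F (φ S)) (G := fun S => G (φ S)) (fun S T hST => hF (hφm hST))
    (fun S T hST => hG (hφm hST)) (pull F D₁ hFD) (pull G D₂ hGD) hdisjU

/-- The non-increasing indicator case (decreasing events `𝒟_j`): flip, then take increasing images — the
indicator vector of decreasing events of disjoint blocks is NA. [cite: DubhashiRanjan1998, §2.1 Prop. 7 (2)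
("all non-increasing")] -/
theorem IsNegAssoc.eventImage_antitone {μ : Finset σ → ℝ} (hμ : IsNegAssoc μ) {𝒟 : κ → Finset (Finset σ)}
    (h𝒟 : ∀ j, IsLowerSet (𝒟 j : Set (Finset σ))) {I : κ → Finset σ}
    (hI : ∀ j, DeterminedBy (setInd (𝒟 j)) (I j)) (hdisj : ∀ j l, j ≠ l → Disjoint (I j) (I l)) :
    IsNegAssoc (Literature.Probability.NegativeDependence.eventImage 𝒟 μ) := by
  -- `𝒟_j` as an increasing event of the flipped family: `𝒜_j = {S : Sᶜ ∈ 𝒟_j}`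
  set 𝒜 : κ → Finset (Finset σ) := fun j => Finset.univ.filter fun S => Sᶜ ∈ 𝒟 j with h𝒜
  have h𝒜up : ∀ j, IsUpperSet (𝒜 j : Set (Finset σ)) := fun j S T hST hS => by
    rw [Finset.mem_coe, h𝒜, Finset.mem_filter] at hS ⊢
    exact ⟨Finset.mem_univ _, h𝒟 j (Finset.compl_subset_compl.2 hST) hS.2⟩
  have h𝒜I : ∀ j, DeterminedBy (setInd (𝒜 j)) (I j) := fun j S T hST => by
    have key := (hI j).comp_compl S T hST
    simp only [setInd_apply, h𝒜, Finset.mem_filter, Finset.mem_univ, true_and] at key ⊢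
    exact key
  have key := hμ.flip.eventImage h𝒜up h𝒜I hdisj
  have heq : Literature.Probability.NegativeDependence.eventImage 𝒜 (flipWeight μ) =
      Literature.Probability.NegativeDependence.eventImage 𝒟 μ := by
    funext J
    rw [eventImage_apply, eventImage_apply]
    refine Fintype.sum_equiv (Equiv.mk (fun S : Finset σ => Sᶜ) (fun S => Sᶜ) compl_compl compl_compl) _ _
      fun S => ?_
    simp only [Equiv.coe_fn_mk, flipWeight_apply, h𝒜, Finset.mem_filter, Finset.mem_univ, true_and]
  rwa [heq] at key

/-- **Dubhashi–Ranjan, Proposition 7 (2)** (0/1-valued `h_j`): both monotone cases. [cite: DubhashiRanjan1998,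
§2.1 Prop. 7 (2); JoagDevProschan1983, Property P6] -/
theorem DubhashiRanjan_prop_7_2 {μ : Finset σ → ℝ} (hμ : IsNegAssoc μ) {𝒜 : κ → Finset (Finset σ)}
    {I : κ → Finset σ} (hI : ∀ j, DeterminedBy (setInd (𝒜 j)) (I j)) (hdisj : ∀ j l, j ≠ l → Disjoint (I j) (I l)) :
    ((∀ j, IsUpperSet (𝒜 j : Set (Finset σ))) → IsNegAssoc (eventImage 𝒜 μ)) ∧
      ((∀ j, IsLowerSet (𝒜 j : Set (Finset σ))) → IsNegAssoc (eventImage 𝒜 μ)) :=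
  ⟨fun h => hμ.eventImage h hI hdisj, fun h => hμ.eventImage_antitone h hI hdisj⟩

end Image

end Literature.Probability.NegativeDependence

end
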